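/-
Soloist `solo-ValiantsHypothesis-informed`, session 24 — pencils of `2 × 2` matrices: the pencil
lemma and the second-generation identity (note `paper/quadspan.md` §7.18, Lemma 7.80 and
Proposition 7.81).
-/
import Mathlib

/-!
# Pencils of `2 × 2` matrices: at most three monomial values; the second-generation identity

Setting of the soloist note `paper/quadspan.md` §7.18.  A product-rank-2 target of a space `L'` of
functions is an exponent `e` with `z ^ e = det N` for a `2 × 2` matrix `N` with entries in `L'`; the
monomials `z ^ e` are linearly independent over the constants.  On a PENCIL `N₁ + x • N₂` the
determinant is `A + x B + x² C` (`soloInformed_det_add_smul_fin_two`), so all its values lie in the span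
of three vectors, and a linearly independent family inside the span of a finite set `S` has at most
`S.card` members (`soloInformed_card_le_of_mem_span`); hence a pencil carries at most three targets
with distinct exponents (`soloInformed_pencil_card_le_three`, Lemma 7.80).  The second-generation
mechanism of Proposition 7.81 is the pair of identities `det (N₁ * R) = det N₁ * det R` and, for
`2 × 2` matrices, `det (N₁ * (1 + R)) = det N₁ * (1 + trace R + det R)`
(`soloInformed_det_one_add_fin_two`, `soloInformed_secondGeneration`): with `det R = z ^ a` and
`trace R = c z ^ b - 1 - z ^ a` the three matrices `N₁, N₁ R, N₁ (1 + R)` have determinants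
`z ^ e₁, z ^ (e₁ + a), c z ^ (e₁ + b)`.
-/

namespace Summit.ValiantsHypothesis.ValiantsHypothesis.Theorems

section Span

variable {K M : Type*} [DivisionRing K] [AddCommGroup M] [Module K M]

/-- A linearly independent family all of whose members lie in the span of a finite set `S` has at
most `S.card` members. -/
theorem soloInformed_card_le_of_mem_span {P : Type*} [Fintype P] (v : P → M)
    (hv : LinearIndependent K v) (S : Finset M)
    (hmem : ∀ p, v p ∈ Submodule.span K (S : Set M)) : Fintype.card P ≤ S.card := by
  set W : Submodule K M := Submodule.span K (S : Set M) with hW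
  haveI : Module.Finite K W := Module.Finite.span_of_finite K S.finite_toSet
  let v' : P → W := fun p => ⟨v p, hmem p⟩
  have hv' : LinearIndependent K v' := by
    apply LinearIndependent.of_comp W.subtype
    exact hv
  calc Fintype.card P ≤ Module.finrank K W := hv'.fintype_card_le_finrank
    _ ≤ S.card := finrank_span_finset_le_card S

/-- **Lemma 7.80 (pencil lemma).**  Let `χ` be a linearly independent family (the monomials) and
suppose the quadratic expression `A + ρ p • B + ρ p ^ 2 • C` equals a non-zero multiple of
`χ (e p)` for every `p`, with `e` injective (pairwise distinct exponents).  Then there are at most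
three such `p`. -/
theorem soloInformed_pencil_card_le_three {P ι : Type*} [Fintype P] (χ : ι → M)
    (hχ : LinearIndependent K χ) (A B C : M) (ρ c : P → K) (e : P → ι)
    (he : Function.Injective e) (hc : ∀ p, c p ≠ 0)
    (hval : ∀ p, A + ρ p • B + ρ p ^ 2 • C = c p • χ (e p)) : Fintype.card P ≤ 3 := by
  classical
  -- the values `c p • χ (e p)` are linearly independent
  have h1 : LinearIndependent K (χ ∘ e) := hχ.comp e he
  have h2 : LinearIndependent K (fun p => c p • χ (e p)) := by
    have := h1.units_smul (fun p => Units.mk0 (c p) (hc p))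
    convert this using 1
    funext p
    simp [Units.smul_def]
  -- and they all lie in the span of `{A, B, C}`
  have h3 : ∀ p, c p • χ (e p) ∈ Submodule.span K (({A, B, C} : Finset M) : Set M) := by
    intro p
    rw [← hval p]
    have hA : A ∈ Submodule.span K (({A, B, C} : Finset M) : Set M) :=
      Submodule.subset_span (by simp)
    have hB : B ∈ Submodule.span K (({A, B, C} : Finset M) : Set M) :=
      Submodule.subset_span (by simp)
    have hC : C ∈ Submodule.span K (({A, B, C} : Finset M) : Set M) :=
      Submodule.subset_span (by simp)
    exact Submodule.add_mem _ (Submodule.add_mem _ hA (Submodule.smul_mem _ _ hB))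
      (Submodule.smul_mem _ _ hC)
  calc Fintype.card P ≤ ({A, B, C} : Finset M).card :=
        soloInformed_card_le_of_mem_span _ h2 _ h3
    _ ≤ 3 := Finset.card_le_three

end Span

section TwoByTwo

open Matrix

variable {R : Type*} [CommRing R]

/-- For `2 × 2` matrices, `det (1 + N) = 1 + trace N + det N`. -/
theorem soloInformed_det_one_add_fin_two (N : Matrix (Fin 2) (Fin 2) R) :
    (1 + N).det = 1 + N.trace + N.det := by
  simp only [Matrix.det_fin_two, Matrix.trace_fin_two, Matrix.add_apply, Matrix.one_apply_eq,
    Matrix.one_apply_ne (by decide : (0 : Fin 2) ≠ 1), Matrix.one_apply_ne (by decide : (1 : Fin 2) ≠ 0)]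
  ring

/-- The determinant along a pencil of `2 × 2` matrices is a quadratic polynomial in the pencil
parameter: `det (N₁ + x • N₂) = det N₁ + x * D + x ^ 2 * det N₂` with
`D = det (N₁ + N₂) - det N₁ - det N₂` (the polarisation of `det`). -/
theorem soloInformed_det_add_smul_fin_two (N₁ N₂ : Matrix (Fin 2) (Fin 2) R) (x : R) :
    (N₁ + x • N₂).det
      = N₁.det + x * ((N₁ + N₂).det - N₁.det - N₂.det) + x ^ 2 * N₂.det := by
  simp only [Matrix.det_fin_two, Matrix.add_apply, Matrix.smul_apply, smul_eq_mul]
  ring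

/-- **Proposition 7.81 (second-generation identity).**  If `det N₁ = m`, `det Rm = d` and
`trace Rm = u - 1 - d`, then `det (N₁ * Rm) = m * d` and `det (N₁ * (1 + Rm)) = m * u`: with
`m = z ^ e₁`, `d = z ^ a`, `u = c * z ^ b` the matrices `N₁, N₁ Rm, N₁ (1 + Rm)` — the third a
member of the pencil of the first two — have the monomial determinants `z ^ e₁`, `z ^ (e₁ + a)`,
`c * z ^ (e₁ + b)`. -/
theorem soloInformed_secondGeneration (N₁ Rm : Matrix (Fin 2) (Fin 2) R) {m d u : R}
    (hN : N₁.det = m) (hd : Rm.det = d) (ht : Rm.trace = u - 1 - d) :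
    (N₁ * Rm).det = m * d ∧ (N₁ * (1 + Rm)).det = m * u := by
  refine ⟨by rw [Matrix.det_mul, hN, hd], ?_⟩
  rw [Matrix.det_mul, soloInformed_det_one_add_fin_two, hN, hd, ht]
  ring

/-- The monomial instance over a polynomial ring: `det N₁ = X ^ e₁`, `det Rm = X ^ a`,
`trace Rm = C c * X ^ b - 1 - X ^ a` give determinants `X ^ (e₁ + a)` and `C c * X ^ (e₁ + b)`. -/
theorem soloInformed_secondGeneration_monomial {S : Type*} [CommRing S]
    (N₁ Rm : Matrix (Fin 2) (Fin 2) (Polynomial S)) {e₁ a b : ℕ} {c : S}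
    (hN : N₁.det = Polynomial.X ^ e₁) (hd : Rm.det = Polynomial.X ^ a)
    (ht : Rm.trace = Polynomial.C c * Polynomial.X ^ b - 1 - Polynomial.X ^ a) :
    (N₁ * Rm).det = Polynomial.X ^ (e₁ + a) ∧
      (N₁ * (1 + Rm)).det = Polynomial.C c * Polynomial.X ^ (e₁ + b) := by
  obtain ⟨h1, h2⟩ := soloInformed_secondGeneration N₁ Rm hN hd ht
  refine ⟨by rw [h1, pow_add], by rw [h2, pow_add]; ring⟩

end TwoByTwo

end Summit.ValiantsHypothesis.ValiantsHypothesis.Theorems
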